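import Mathlib
import HarnessLib
import Literature.NumberTheory.LFunctions.VinogradovMeanValueFirstClass

/-!
# Vinogradov's mean value theorem, VI: the recurrent inequality (Ivić, Lemma 6.2) and the
# explicit bound (Ivić, Lemma 6.3)

Topic `Literature/NumberTheory/LFunctions`. Everything in this file is PROVED (no named facts).

**Ivić, Lemma 6.2.** Let `n ≥ 2`, `P ≥ (2n)^{3n}` and `k ≥ n² + n`. Then
`J_{k,n}(P) ≤ 4^{2k} P^{2k/n + (3n−5)/2} J_{k−n,n}(P₁)` for some `P^{1−1/n} ≤ P₁ ≤ 4P^{1−1/n}`.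

**Ivić, Lemma 6.3 (Vinogradov's mean value theorem).** Let `r ≥ 0`, `k ≥ n² + nr`, `P ≥ P₀` and
`c_r = ½(n² + n)(1 − 1/n)^r`. Then `J_{k,n}(P) ≤ (4n)^{4kr} P^{2k − (n²+n)/2 + c_r}`.

Here `J_{k,n}(I) = VMV.J n k I` is the number of solutions of Vinogradov's system
`∑_{i≤k} x_i^j = ∑_{i≤k} y_i^j` (`1 ≤ j ≤ n`) with variables in the finite set `I ⊂ ℤ`
(`VinogradovMeanValueCount.lean`), and the two lemmas are proved in the forms

* `VMV.lemma62`: for `n ≥ 2`, `k ≥ n² + n`, `P ≥ n^{4n}` there is `P^{1−1/n} < P₁ ≤ 3P^{1−1/n}` with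
  `J_{k,n}([1,P]) ≤ C₆₂(n,k) · P^{2k/n + (3n−5)/2} · J_{k−n,n}([1,P₁])`,
  `C₆₂(n,k) = 2·9ⁿ + k^{2n} n! 2^{n²} 3ⁿ` (`VMV.C62`; Ivić bounds the corresponding quantity by
  `4^{2k}` using `k ≥ n² + n`; the threshold `n^{4n}` replaces `(2n)^{3n}` — either serves only to
  absorb the factor `n^k` of the second class and to have a prime `n < p ≤ P^{1/n}`);
* `VMV.lemma63`: for `n ≥ 2`, `k ≥ n² + nr` and ALL `P ≥ 1`,
  `J_{k,n}([1,P]) ≤ K(n,k)^r · n^{2n²(n+1)} · P^{2k − (n²+n)/2 + c_r}`, `K(n,k) = 9^k C₆₂(n,k)`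
  (`VMV.K63`, `VMV.cr`); the factor `n^{2n²(n+1)} = (n^{4n})^{(n²+n)/2}` pays for `P < n^{4n}` (trivial
  bound) and replaces Ivić's two-level induction over the thresholds `(2n)^{3n(1+1/(n−1))^r}`, the
  factor `9^k` per step absorbs `P₁ ≤ 3P^{1−1/n}`; `VMV.lemma63_five_sq` is the case `k = 5n²`,
  `r = 4n` used for the zeta sums (Ivić (6.44)–(6.46), `R = 4`).

Only the shape `exp(O(r(k log k + n²) + n³ log n))` of the constants matters for the application
(Theorem 6.2, where `k ≍ n²`, `r ≍ n` and a `4k²`-th root is taken).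

## Proof of Lemma 6.2 (Ivić pp. 149–151, with the inputs of parts III–V)

Choose a prime `P^{1/n}/2 < p ≤ P^{1/n}` (Bertrand) and `P₁ = ⌊P/p⌋ + 1`, so `[1,P] ⊆ [1,pP₁]`.
Split the solutions in `[1,pP₁]^{2k}` by the digit patterns `x_i = X_i mod p`:
* second class (some side has `< n` distinct digits): `≤ 2 · n^k p^{n−1} · p^k · J_{k,n}([0,P₁))`
  (`VMV.card_sol_deg_le`, part III, and the swap `X ↔ Y`), and `J_{k,n} ≤ P₁^{2n} J_{k−n,n}`
  (Ivić (6.32), `VMV.J_add_le`);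
* first class (both sides have `≥ n` distinct digits): choosing on each side `n` positions
  carrying distinct digits (`≤ k^n` choices each) and permuting them to the front
  (`VMV.extendPerm`), `≤ k^{2n} J₁'` with `J₁'` the count with the first `n` digits distinct,
  and `J₁' ≤ p^{2(k−n)} (pP₁)ⁿ n! mⁿ p^{n(n−1)/2} J_{k−n,n}([0,P₁))`, `m = ⌊P/pⁿ⌋ + 1 ≤ 2ⁿ`
  (`VMV.firstClassProd_le`, part V: Hölder and Linnik's lemma, part IV).
Finally `p ≤ P^{1/n}`, `P₁ ≤ 3P^{1−1/n}`, and `n^k ≤ P^{k/n − n/2 − 3/2 + 1/n}` for `P ≥ n^{4n}`,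
`k ≥ n² + n`. Lemma 6.3 follows by induction on `r`, using
`(1 − 1/n)(2(k−n) − (n²+n)/2 + c_r) + 2k/n + (3n−5)/2 = 2k − (n²+n)/2 + c_{r+1}`.

## References

* A. Ivić, *The Riemann Zeta-Function*, John Wiley & Sons 1985 (Dover 2003), §6.2, Lemmas 6.2
  and 6.3, pp. 149–152. [cite: Ivic1985, Lemma 6.2] [cite: Ivic1985, Lemma 6.3]
* Mathlib, `Nat.exists_prime_lt_and_le_two_mul` (Bertrand's postulate).
-/

noncomputable section

open Finset
open scoped Real

namespace Literature.NumberTheory.LFunctions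
namespace VMV


/-! ### Permutation invariance and the choice of positions -/

/-- Power sums are invariant under permutations of the variables. [folklore] -/
theorem psv_comp_perm {n k : ℕ} (X : Fin k → ℤ) (σ : Equiv.Perm (Fin k)) :
    psv n (X ∘ σ) = psv n X := by
  funext j
  simp only [psv, Function.comp]
  exact Equiv.sum_comp σ (fun i => X i ^ (j.val + 1))

/-- A permutation of `Fin (n + s)` moving `g(0), …, g(n−1)` to the first `n` places, for an
injective `g : Fin n → Fin (n + s)` ("relabeling the solutions", Ivić p. 149). [folklore] -/
def extendPerm {n s : ℕ} (g : Fin n → Fin (n + s)) (hg : Function.Injective g) :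
    Equiv.Perm (Fin (n + s)) := by
  classical
  have hc : Fintype.card ((Set.range g)ᶜ : Set (Fin (n + s))) = s := by
    rw [Fintype.card_compl_set, Set.card_range_of_injective hg, Fintype.card_fin, Fintype.card_fin]
    omega
  exact finSumFinEquiv.symm.trans (((Equiv.ofInjective g hg).sumCongr
    (Fintype.equivFinOfCardEq hc).symm).trans (Equiv.Set.sumCompl (Set.range g)))

/-- `extendPerm g (castAdd s i) = g i`. [folklore] -/
theorem extendPerm_castAdd {n s : ℕ} (g : Fin n → Fin (n + s)) (hg : Function.Injective g)
    (i : Fin n) : extendPerm g hg (Fin.castAdd s i) = g i := by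
  classical
  unfold extendPerm
  simp [finSumFinEquiv_symm_apply_castAdd, Equiv.Set.sumCompl_apply_inl]

/-- A nondegenerate pattern (at least `n` distinct values) has `n` positions carrying distinct
values. [folklore] -/
theorem exists_injective_comp_of_not_isDegPat {n k : ℕ} {x : Fin k → ℤ} (h : ¬ IsDegPat n x) :
    ∃ g : Fin n → Fin k, Function.Injective (fun i => x (g i)) := by
  classical
  unfold IsDegPat at h
  push Not at h
  obtain ⟨T, hTsub, hTcard⟩ := Finset.exists_subset_card_eq h
  have hpre : ∀ t : Fin n, ∃ i : Fin k, x i = T.orderEmbOfFin hTcard t := by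
    intro t
    have ht : T.orderEmbOfFin hTcard t ∈ univ.image x := hTsub (Finset.orderEmbOfFin_mem T hTcard t)
    obtain ⟨i, -, hi⟩ := mem_image.1 ht
    exact ⟨i, hi⟩
  choose g hg using hpre
  refine ⟨g, fun t t' htt' => ?_⟩
  have : T.orderEmbOfFin hTcard t = T.orderEmbOfFin hTcard t' := by
    have h1 := hg t; have h2 := hg t'
    simp only at htt'
    rw [← h1, ← h2]; exact htt'
  exact (T.orderEmbOfFin hTcard).injective this

/-! ### The solutions in `[1, pP₁]^{n+s}` split by digit patterns -/

/-- The solution set `{(X, Y) ∈ [1,pP₁]^{k} × [1,pP₁]^{k} : s(X) = s(Y)}` (so that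
`J_{k,n}([1,pP₁]) = #Sol`). [cite: Ivic1985, (6.9)] -/
def Sol (n k p P₁ : ℕ) : Finset ((Fin k → ℤ) × (Fin k → ℤ)) :=
  (tuples k (IQ p P₁) ×ˢ tuples k (IQ p P₁)).filter (fun XY => psv n XY.1 = psv n XY.2 + 0)

/-- `J_{k,n}([1,pP₁]) = #Sol`. [folklore] -/
theorem J_IQ_eq_card_Sol (n k p P₁ : ℕ) : J n k (IQ p P₁) = (Sol n k p P₁).card := rfl

/-- **Second class, `X`-side**: `#{(X,Y) ∈ Sol : digits of X degenerate} ≤ p^{n−1} n^k · p^k · J_{k,n}([0,P₁))`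
(part III, `card_sol_deg_le` with `card_degPat_le`). [cite: Ivic1985, Lemma 6.2 (proof, `J₂`)] -/
theorem card_Sol_degX_le {n k p P₁ : ℕ} (hp : p.Prime) (hn : 1 ≤ n) (hnp : n ≤ p) (hk : 1 ≤ k) :
    ((Sol n k p P₁).filter (fun XY => IsDegPat n (fun i => digit p (XY.1 i)))).card ≤
      (p ^ (n - 1) * n ^ k) * p ^ k * J n k (Yset P₁) := by
  classical
  have h1 := card_sol_deg_le (n := n) (k := k) (P₁ := P₁) hp.pos hk
  have h2 : ((Sol n k p P₁).filter (fun XY => IsDegPat n (fun i => digit p (XY.1 i)))) =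
      ((tuples k (IQ p P₁) ×ˢ tuples k (IQ p P₁)).filter (fun XY => psv n XY.1 = psv n XY.2 + 0 ∧
        IsDegPat n (fun i => digit p (XY.1 i)))) := by
    rw [Sol, filter_filter]
  rw [h2]
  have h3 : (((tuples k (IQ p P₁) ×ˢ tuples k (IQ p P₁)).filter (fun XY => psv n XY.1 = psv n XY.2 + 0 ∧
        IsDegPat n (fun i => digit p (XY.1 i)))).card : ℝ) ≤
      ((p ^ (n - 1) * n ^ k : ℕ) : ℝ) * (p : ℝ) ^ k * J n k (Yset P₁) := by
    refine h1.trans ?_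
    gcongr
    exact_mod_cast card_degPat_le hn hnp
  exact_mod_cast h3

/-- **Second class, `Y`-side**, by the symmetry `(X, Y) ↦ (Y, X)` of the solution set. [folklore] -/
theorem card_Sol_degY_eq {n k p P₁ : ℕ} :
    ((Sol n k p P₁).filter (fun XY => IsDegPat n (fun i => digit p (XY.2 i)))).card =
      ((Sol n k p P₁).filter (fun XY => IsDegPat n (fun i => digit p (XY.1 i)))).card := by
  classical
  refine card_nbij' Prod.swap Prod.swap ?_ ?_ (fun _ _ => by simp) (fun _ _ => by simp)
  · intro XY hXY
    rw [mem_coe, mem_filter, Sol, mem_filter, mem_product] at hXY ⊢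
    simp only [Prod.fst_swap, Prod.snd_swap, add_zero] at hXY ⊢
    exact ⟨⟨⟨hXY.1.1.2, hXY.1.1.1⟩, hXY.1.2.symm⟩, hXY.2⟩
  · intro XY hXY
    rw [mem_coe, mem_filter, Sol, mem_filter, mem_product] at hXY ⊢
    simp only [Prod.fst_swap, Prod.snd_swap, add_zero] at hXY ⊢
    exact ⟨⟨⟨hXY.1.1.2, hXY.1.1.1⟩, hXY.1.2.symm⟩, hXY.2⟩

/-- **First class with prescribed positions**: for `g, g' : Fin n → Fin (n+s)`, the solutions whose
digits at the positions `g(·)` (for `X`) and `g'(·)` (for `Y`) are distinct number at most `J₁'`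
(`firstClassProd`): permute these positions to the front. [cite: Ivic1985, Lemma 6.2 (proof, `J₁ ≤ k^{2n} J₁'`)] -/
theorem card_Sol_positions_le {n s p P₁ : ℕ} (g g' : Fin n → Fin (n + s)) :
    ((Sol n (n + s) p P₁).filter (fun XY => Function.Injective (fun i => digit p (XY.1 (g i))) ∧
        Function.Injective (fun i => digit p (XY.2 (g' i))))).card ≤ firstClassProd n s p P₁ := by
  classical
  set C := ((Sol n (n + s) p P₁).filter (fun XY => Function.Injective (fun i => digit p (XY.1 (g i))) ∧
        Function.Injective (fun i => digit p (XY.2 (g' i))))) with hC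
  rcases C.eq_empty_or_nonempty with h0 | ⟨XY₀, hXY₀⟩
  · rw [h0, card_empty]; exact Nat.zero_le _
  -- `g, g'` are injective
  rw [hC, mem_filter] at hXY₀
  have hg : Function.Injective g := Function.Injective.of_comp (f := fun t => digit p (XY₀.1 t)) hXY₀.2.1
  have hg' : Function.Injective g' := Function.Injective.of_comp (f := fun t => digit p (XY₀.2 t)) hXY₀.2.2
  set σ := extendPerm g hg with hσ
  set σ' := extendPerm g' hg' with hσ'
  -- the map to product coordinates
  set Φ : ((Fin (n + s) → ℤ) × (Fin (n + s) → ℤ)) →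
      ((Fin n → ℤ) × (Fin s → ℤ)) × ((Fin n → ℤ) × (Fin s → ℤ)) := fun XY =>
    (((fun i => XY.1 (σ (Fin.castAdd s i))), (fun l => XY.1 (σ (Fin.natAdd n l)))),
      ((fun i => XY.2 (σ' (Fin.castAdd s i))), (fun l => XY.2 (σ' (Fin.natAdd n l))))) with hΦ
  have happ : ∀ (F : Fin (n + s) → ℤ) (τ : Equiv.Perm (Fin (n + s))),
      Fin.append (fun i => F (τ (Fin.castAdd s i))) (fun l => F (τ (Fin.natAdd n l))) = F ∘ τ :=
    fun F τ => Fin.append_castAdd_natAdd (f := F ∘ τ)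
  unfold firstClassProd
  refine card_le_card_of_injOn Φ (fun XY hXY => ?_) ?_
  · rw [mem_coe, hC, mem_filter, Sol, mem_filter, mem_product, mem_tuples, mem_tuples] at hXY
    obtain ⟨⟨⟨hX, hY⟩, heq⟩, hinjX, hinjY⟩ := hXY
    rw [add_zero] at heq
    rw [mem_coe, mem_filter, mem_product, mem_product, mem_product]
    refine ⟨⟨⟨?_, mem_tuples.2 fun l => hX _⟩, ?_, mem_tuples.2 fun l => hY _⟩, ?_⟩
    · rw [Dinj, mem_filter, mem_tuples]
      refine ⟨fun i => hX _, ?_⟩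
      simp only [hΦ, hσ, extendPerm_castAdd]
      exact hinjX
    · rw [Dinj, mem_filter, mem_tuples]
      refine ⟨fun i => hY _, ?_⟩
      simp only [hΦ, hσ', extendPerm_castAdd]
      exact hinjY
    · simp only [hΦ]
      rw [← psv_append, ← psv_append, happ, happ, psv_comp_perm, psv_comp_perm, heq]
  · intro XY _ XY' _ h
    simp only [hΦ, Prod.mk.injEq] at h
    obtain ⟨⟨h11, h12⟩, h21, h22⟩ := h
    have e1 : XY.1 ∘ σ = XY'.1 ∘ σ := by
      rw [← happ XY.1 σ, ← happ XY'.1 σ, h11, h12]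
    have e2 : XY.2 ∘ σ' = XY'.2 ∘ σ' := by
      rw [← happ XY.2 σ', ← happ XY'.2 σ', h21, h22]
    refine Prod.ext ?_ ?_
    · funext t; have := congr_fun e1 (σ.symm t); simpa using this
    · funext t; have := congr_fun e2 (σ'.symm t); simpa using this

/-- **First class**: the solutions with both digit patterns nondegenerate number at most
`(n+s)^{2n} J₁'` (a nondegenerate pattern has `n` positions with distinct digits; `≤ (n+s)^n`
choices of positions on each side). [cite: Ivic1985, Lemma 6.2 (proof, "`J₁ ≤ k^{2n} J₁'`")] -/
theorem card_Sol_nondeg_le {n s p P₁ : ℕ} :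
    ((Sol n (n + s) p P₁).filter (fun XY => ¬ IsDegPat n (fun i => digit p (XY.1 i)) ∧
        ¬ IsDegPat n (fun i => digit p (XY.2 i)))).card ≤
      (n + s) ^ (2 * n) * firstClassProd n s p P₁ := by
  classical
  set Cl := fun gg' : (Fin n → Fin (n + s)) × (Fin n → Fin (n + s)) =>
    (Sol n (n + s) p P₁).filter (fun XY => Function.Injective (fun i => digit p (XY.1 (gg'.1 i))) ∧
        Function.Injective (fun i => digit p (XY.2 (gg'.2 i)))) with hCl
  have hcover : ((Sol n (n + s) p P₁).filter (fun XY => ¬ IsDegPat n (fun i => digit p (XY.1 i)) ∧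
        ¬ IsDegPat n (fun i => digit p (XY.2 i)))) ⊆ univ.biUnion Cl := by
    intro XY hXY
    rw [mem_filter] at hXY
    obtain ⟨g, hg⟩ := exists_injective_comp_of_not_isDegPat hXY.2.1
    obtain ⟨g', hg'⟩ := exists_injective_comp_of_not_isDegPat hXY.2.2
    rw [mem_biUnion]
    refine ⟨(g, g'), mem_univ _, ?_⟩
    rw [hCl, mem_filter]
    exact ⟨hXY.1, hg, hg'⟩
  calc _ ≤ (univ.biUnion Cl).card := card_le_card hcover
    _ ≤ ∑ gg' ∈ univ, (Cl gg').card := card_biUnion_le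
    _ ≤ ∑ _gg' ∈ (univ : Finset ((Fin n → Fin (n + s)) × (Fin n → Fin (n + s)))), firstClassProd n s p P₁ :=
        sum_le_sum fun gg' _ => card_Sol_positions_le gg'.1 gg'.2
    _ = (n + s) ^ (2 * n) * firstClassProd n s p P₁ := by
        rw [sum_const, card_univ, smul_eq_mul, Fintype.card_prod, Fintype.card_fun, Fintype.card_fin,
          Fintype.card_fin]
        ring

/-- **The structural recurrence** (Ivić (6.24)–(6.26) and the bound for `J₂`, for an arbitrary
prime `p > n`): for `n, s ≥ 1` and `pP₁ ≤ m pⁿ`,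
`J_{n+s,n}([1,pP₁]) ≤ (2 n^{n+s} p^{n−1} p^{n+s} P₁^{2n} + (n+s)^{2n} p^{2s} (pP₁)ⁿ n! mⁿ p^{n(n−1)/2}) · J_{s,n}([0,P₁))`.
[cite: Ivic1985, Lemma 6.2 (proof)] -/
theorem J_IQ_le_struct {n s p P₁ m : ℕ} (hp : p.Prime) (hnp : n < p) (hn : 1 ≤ n) (hs : 1 ≤ s)
    (hm : p * P₁ ≤ m * p ^ n) :
    J n (n + s) (IQ p P₁) ≤
      (2 * ((p ^ (n - 1) * n ^ (n + s)) * p ^ (n + s) * P₁ ^ (2 * n)) +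
        (n + s) ^ (2 * n) * (p ^ (2 * s) * (p * P₁) ^ n *
          (Nat.factorial n * m ^ n * p ^ (n * (n - 1) / 2)))) * J n s (Yset P₁) := by
  classical
  set S := Sol n (n + s) p P₁ with hS
  set DX := fun XY : (Fin (n + s) → ℤ) × (Fin (n + s) → ℤ) => IsDegPat n (fun i => digit p (XY.1 i)) with hDX
  set DY := fun XY : (Fin (n + s) → ℤ) × (Fin (n + s) → ℤ) => IsDegPat n (fun i => digit p (XY.2 i)) with hDY
  -- the splitting
  have hsplit : S.card ≤ (S.filter DX).card + (S.filter DY).card +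
      (S.filter (fun XY => ¬ DX XY ∧ ¬ DY XY)).card := by
    have h1 := card_filter_add_card_filter_not (s := S) DX
    have h2 := card_filter_add_card_filter_not (s := S.filter (fun XY => ¬ DX XY)) DY
    rw [filter_filter, filter_filter] at h2
    have h3 : ((S.filter (fun XY => ¬ DX XY ∧ DY XY))).card ≤ (S.filter DY).card :=
      card_le_card (fun XY hXY => by rw [mem_filter] at hXY ⊢; exact ⟨hXY.1, hXY.2.2⟩)
    omega
  -- the degenerate classes
  have hdeg : (S.filter DX).card ≤ (p ^ (n - 1) * n ^ (n + s)) * p ^ (n + s) * (P₁ ^ (2 * n) * J n s (Yset P₁)) := by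
    refine (card_Sol_degX_le hp hn hnp.le (by omega)).trans ?_
    refine Nat.mul_le_mul_left _ ?_
    have := J_add_le n n s (Yset P₁)
    rwa [card_Yset] at this
  have hdegY : (S.filter DY).card = (S.filter DX).card := card_Sol_degY_eq
  -- the first class
  have hfirst : (S.filter (fun XY => ¬ DX XY ∧ ¬ DY XY)).card ≤
      (n + s) ^ (2 * n) * (p ^ (2 * s) * (p * P₁) ^ n *
          (Nat.factorial n * m ^ n * p ^ (n * (n - 1) / 2)) * J n s (Yset P₁)) := by
    refine (card_Sol_nondeg_le (n := n) (s := s) (p := p) (P₁ := P₁)).trans ?_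
    refine Nat.mul_le_mul_left _ ?_
    have h := firstClassProd_le (n := n) (s := s) hp hnp hs hm
    exact_mod_cast h
  rw [J_IQ_eq_card_Sol]
  calc (Sol n (n + s) p P₁).card ≤ (S.filter DX).card + (S.filter DY).card +
      (S.filter (fun XY => ¬ DX XY ∧ ¬ DY XY)).card := hsplit
    _ ≤ (p ^ (n - 1) * n ^ (n + s)) * p ^ (n + s) * (P₁ ^ (2 * n) * J n s (Yset P₁)) +
        (p ^ (n - 1) * n ^ (n + s)) * p ^ (n + s) * (P₁ ^ (2 * n) * J n s (Yset P₁)) +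
        (n + s) ^ (2 * n) * (p ^ (2 * s) * (p * P₁) ^ n *
          (Nat.factorial n * m ^ n * p ^ (n * (n - 1) / 2)) * J n s (Yset P₁)) := by
        rw [hdegY]; exact Nat.add_le_add (Nat.add_le_add hdeg hdeg) hfirst
    _ = _ := by ring

/-! ### The choice of `p`, `P₁`, `m`, and Lemma 6.2 -/

/-- **Bertrand**: for real `x ≥ 2` there is a prime `x/2 < p ≤ x` (Ivić: "such a prime exists e.g.,
by the prime number theorem"). [folklore] -/
theorem exists_prime_half_lt_le {x : ℝ} (hx : 2 ≤ x) : ∃ p : ℕ, p.Prime ∧ x / 2 < p ∧ (p : ℝ) ≤ x := by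
  set a : ℕ := ⌊x / 2⌋₊ with ha
  have ha1 : 1 ≤ a := by
    rw [ha]; exact Nat.le_floor (by norm_num; linarith)
  obtain ⟨p, hp, hap, hpa⟩ := Nat.exists_prime_lt_and_le_two_mul a (by omega)
  refine ⟨p, hp, ?_, ?_⟩
  · calc x / 2 < (a : ℝ) + 1 := Nat.lt_floor_add_one _
      _ ≤ p := by exact_mod_cast hap
  · calc (p : ℝ) ≤ 2 * a := by exact_mod_cast hpa
      _ ≤ 2 * (x / 2) := by
          have : (a : ℝ) ≤ x / 2 := Nat.floor_le (by linarith)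
          linarith
      _ = x := by ring

/-- `[0, P₁) + 1 = [1, P₁]`. [folklore] -/
theorem Yset_image_add_one (P₁ : ℕ) : (Yset P₁).image (· + 1) = Finset.Icc (1 : ℤ) P₁ := by
  ext t
  simp only [Yset, mem_image, Finset.mem_Ico, Finset.mem_Icc]
  constructor
  · rintro ⟨y, ⟨h0, h1⟩, rfl⟩; exact ⟨by omega, by omega⟩
  · rintro ⟨h1, h2⟩; exact ⟨t - 1, ⟨by omega, by omega⟩, by ring⟩

/-- `J_{s,n}([1, P₁]) = J_{s,n}([0, P₁))` (translation invariance). [folklore] -/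
theorem J_Icc_eq_J_Yset (n s P₁ : ℕ) : J n s (Finset.Icc (1 : ℤ) P₁) = J n s (Yset P₁) := by
  rw [← Yset_image_add_one, J_translate]

/-- The constant of the recurrent inequality: `C₆₂(n, k) = 2·9ⁿ + k^{2n} n! 2^{n²} 3ⁿ` (Ivić: `4^{2k}`).
[cite: Ivic1985, Lemma 6.2] -/
def C62 (n k : ℕ) : ℝ := 2 * 9 ^ n + (k : ℝ) ^ (2 * n) * (Nat.factorial n) * 2 ^ (n * n) * 3 ^ n

/-- `C₆₂ ≥ 0`. [folklore] -/
theorem C62_nonneg (n k : ℕ) : 0 ≤ C62 n k := by unfold C62; positivity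

/-- **The prime** (step 1 of the proof): for `n ≥ 2` and `P ≥ n^{4n}` there is a prime `p > n` with
`x/2 < p ≤ x`, `x = P^{1/n} ≥ n⁴`; in particular `pⁿ ≤ P < 2ⁿpⁿ`. [cite: Ivic1985, Lemma 6.2 (proof)] -/
theorem lemma62_prime {n P : ℕ} (hn : 2 ≤ n) (hP : n ^ (4 * n) ≤ P) :
    ∃ p : ℕ, p.Prime ∧ n < p ∧ p ^ n ≤ P ∧ P < 2 ^ n * p ^ n ∧
      (n : ℝ) ^ 4 ≤ (P : ℝ) ^ ((n : ℝ)⁻¹) ∧ (p : ℝ) ≤ (P : ℝ) ^ ((n : ℝ)⁻¹) ∧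
        (P : ℝ) ^ ((n : ℝ)⁻¹) < 2 * p := by
  have hn1 : 1 ≤ n := by omega
  have hn0 : (n : ℕ) ≠ 0 := by omega
  have hP1 : 1 ≤ P := le_trans (Nat.one_le_pow _ _ (by omega)) hP
  have hPr : (0 : ℝ) < P := by exact_mod_cast (by omega : 0 < P)
  set x : ℝ := (P : ℝ) ^ ((n : ℝ)⁻¹) with hx
  have hx0 : 0 < x := Real.rpow_pos_of_pos hPr _
  have hxn : x ^ n = (P : ℝ) := by rw [hx]; exact Real.rpow_inv_natCast_pow hPr.le hn0
  have hxn4 : (n : ℝ) ^ 4 ≤ x := by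
    have h1 : ((n : ℝ) ^ 4) ^ n ≤ (P : ℝ) := by
      rw [← pow_mul]; exact_mod_cast hP
    calc (n : ℝ) ^ 4 = (((n : ℝ) ^ 4) ^ n) ^ ((n : ℝ)⁻¹) :=
          (Real.pow_rpow_inv_natCast (by positivity) hn0).symm
      _ ≤ x := by rw [hx]; exact Real.rpow_le_rpow (by positivity) h1 (by positivity)
  have h2n : (2 : ℝ) ≤ n := by exact_mod_cast hn
  have h16 : (16 : ℝ) ≤ (n : ℝ) ^ 4 := by
    have := pow_le_pow_left₀ (by norm_num : (0 : ℝ) ≤ 2) h2n 4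
    norm_num at this
    exact this
  have hx16 : (16 : ℝ) ≤ x := h16.trans hxn4
  obtain ⟨p, hp, hpx, hpx'⟩ := exists_prime_half_lt_le (x := x) (by linarith)
  have hp0 : 0 < p := hp.pos
  have hpr : (0 : ℝ) < p := by exact_mod_cast hp0
  have hnp : n < p := by
    have h3 : (n : ℝ) ≤ (n : ℝ) ^ 4 / 2 := by
      have : (n : ℝ) * 2 ≤ (n : ℝ) ^ 4 := by
        calc (n : ℝ) * 2 ≤ (n : ℝ) * (n : ℝ) ^ 3 := by
              refine mul_le_mul_of_nonneg_left ?_ (by positivity)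
              calc (2 : ℝ) ≤ 2 ^ 3 := by norm_num
                _ ≤ (n : ℝ) ^ 3 := pow_le_pow_left₀ (by norm_num) h2n 3
          _ = (n : ℝ) ^ 4 := by ring
      linarith
    have h1 : (n : ℝ) < p := by linarith
    exact_mod_cast h1
  have hpnP : p ^ n ≤ P := by
    have : (p : ℝ) ^ n ≤ P := by rw [← hxn]; exact pow_le_pow_left₀ hpr.le hpx' n
    exact_mod_cast this
  have hP2p : P < 2 ^ n * p ^ n := by
    have h1 : x < 2 * p := by linarith
    have : (P : ℝ) < (2 * p) ^ n := by
      rw [← hxn]; exact pow_lt_pow_left₀ h1 hx0.le hn0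
    rw [mul_pow] at this
    exact_mod_cast this
  exact ⟨p, hp, hnp, hpnP, hP2p, hxn4, hpx', by linarith⟩

/-- **The parameters `P₁ = ⌊P/p⌋ + 1`, `m = ⌊P/pⁿ⌋ + 1`** (step 2): `[1,P] ⊆ [1,pP₁]`, `pP₁ ≤ m pⁿ`
("we may take `m = [Pp^{-n}] + 1`") and `m ≤ 2ⁿ`. [cite: Ivic1985, Lemma 6.2 (proof)] -/
theorem lemma62_params {n p P : ℕ} (hn1 : 1 ≤ n) (hp0 : 0 < p) (hP2p : P < 2 ^ n * p ^ n) :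
    p * (P / p + 1) ≤ (P / p ^ n + 1) * p ^ n ∧ P < p * (P / p + 1) ∧ P / p ^ n + 1 ≤ 2 ^ n := by
  have hpn0 : 0 < p ^ n := pow_pos hp0 n
  have hPm : P < (P / p ^ n + 1) * p ^ n := by
    rw [add_mul, one_mul]; exact Nat.lt_div_mul_add hpn0
  refine ⟨?_, ?_, ?_⟩
  · have h1 : P / p < (P / p ^ n + 1) * p ^ (n - 1) := by
      rw [Nat.div_lt_iff_lt_mul hp0]
      calc P < (P / p ^ n + 1) * p ^ n := hPm
        _ = (P / p ^ n + 1) * p ^ (n - 1) * p := by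
            rw [mul_assoc, ← pow_succ, Nat.sub_add_cancel hn1]
    calc p * (P / p + 1) ≤ p * ((P / p ^ n + 1) * p ^ (n - 1)) := Nat.mul_le_mul_left _ h1
      _ = (P / p ^ n + 1) * p ^ n := by
          rw [mul_comm, mul_assoc, ← pow_succ, Nat.sub_add_cancel hn1]
  · rw [mul_add, mul_one, mul_comm]; exact Nat.lt_div_mul_add hp0
  · have : P / p ^ n < 2 ^ n := (Nat.div_lt_iff_lt_mul hpn0).2 hP2p
    omega

/-- **`P₁` against `P^{1−1/n} = x^{n−1}`** (step 3): `x^{n−1} < P₁ ≤ 3x^{n−1}` for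
`x/2 < p ≤ x`, `xⁿ = P`, `x ≥ 1`. [cite: Ivic1985, Lemma 6.2 ("`P^{(n-1)/n} ≤ P_1 ≤ 4P^{(n-1)/n}`")] -/
theorem lemma62_P₁_bounds {n p P : ℕ} {x : ℝ} (hn1 : 1 ≤ n) (hp0 : 0 < p) (hx1 : 1 ≤ x)
    (hxn : x ^ n = (P : ℝ)) (hpx : (p : ℝ) ≤ x) (hxp : x < 2 * p) :
    x ^ (n - 1) < ((P / p + 1 : ℕ) : ℝ) ∧ ((P / p + 1 : ℕ) : ℝ) ≤ 3 * x ^ (n - 1) := by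
  have hpr : (0 : ℝ) < p := by exact_mod_cast hp0
  have hx0 : 0 < x := by linarith
  have hPr : (0 : ℝ) ≤ P := Nat.cast_nonneg _
  have hPx : (P : ℝ) / x = x ^ (n - 1) := by
    rw [← hxn, ← Nat.sub_add_cancel hn1, pow_succ, Nat.add_sub_cancel]
    field_simp
  have hxn1' : 1 ≤ x ^ (n - 1) := one_le_pow₀ hx1
  constructor
  · have h1 : (P : ℝ) < ((P / p : ℕ) : ℝ) * p + p := by exact_mod_cast Nat.lt_div_mul_add hp0
    have h2 : (P : ℝ) / p < ((P / p + 1 : ℕ) : ℝ) := by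
      rw [div_lt_iff₀ hpr]; push_cast; linarith
    calc x ^ (n - 1) = (P : ℝ) / x := hPx.symm
      _ ≤ (P : ℝ) / p := div_le_div_of_nonneg_left hPr hpr hpx
      _ < _ := h2
  · have h1 : ((P / p + 1 : ℕ) : ℝ) ≤ (P : ℝ) / p + 1 := by
      push_cast; gcongr; exact Nat.cast_div_le
    have h2 : (P : ℝ) / p ≤ (P : ℝ) / (x / 2) := div_le_div_of_nonneg_left hPr (by linarith) (by linarith)
    rw [div_div_eq_mul_div, mul_comm, mul_div_assoc, hPx] at h2
    linarith

/-- **The sizes of the two classes** (step 4, real arithmetic): with `x ≥ n⁴`, `p ≤ x`,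
`P₁ ≤ 3x^{n−1}`, `m ≤ 2ⁿ`, `k = n + s ≥ n² + n`,
`2 n^k p^{n−1} p^k P₁^{2n} + k^{2n} p^{2s} (pP₁)ⁿ n! mⁿ p^{n(n−1)/2} ≤ C₆₂(n,k) x^{2k + n(3n−5)/2}`
(for the second class `n^k ≤ x^{k + 1 − n(n+3)/2}` because `4(k + 1 − n(n+3)/2) ≥ k`).
[cite: Ivic1985, Lemma 6.2 (proof, (6.26) and the bound for `J₂`)] -/
theorem lemma62_terms_le {n s : ℕ} {x pr P₁r mr : ℝ} (hn : 2 ≤ n) (hk : n ^ 2 + n ≤ n + s)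
    (hxn4 : (n : ℝ) ^ 4 ≤ x) (hpr0 : 0 ≤ pr) (hpx : pr ≤ x) (hP₁0 : 0 ≤ P₁r)
    (hP₁ : P₁r ≤ 3 * x ^ (n - 1)) (hm0 : 0 ≤ mr) (hm : mr ≤ 2 ^ n) :
    2 * ((pr ^ (n - 1) * (n : ℝ) ^ (n + s)) * pr ^ (n + s) * P₁r ^ (2 * n)) +
        ((n + s : ℕ) : ℝ) ^ (2 * n) * (pr ^ (2 * s) * (pr * P₁r) ^ n *
          ((Nat.factorial n : ℝ) * mr ^ n * pr ^ (n * (n - 1) / 2)))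
      ≤ C62 n (n + s) * x ^ (2 * ((n + s : ℕ) : ℝ) + n * (3 * (n : ℝ) - 5) / 2) := by
  have hn1 : 1 ≤ n := by omega
  have hn1r : (1 : ℝ) ≤ n := by exact_mod_cast hn1
  have hn4 : (1 : ℝ) ≤ (n : ℝ) ^ 4 := one_le_pow₀ hn1r
  have hx1 : 1 ≤ x := hn4.trans hxn4
  have hx0 : 0 < x := by linarith
  have hpow : ∀ a : ℕ, pr ^ a ≤ x ^ a := fun a => pow_le_pow_left₀ hpr0 hpx a
  have hP₁pow : ∀ a : ℕ, P₁r ^ a ≤ (3 : ℝ) ^ a * (x ^ (n - 1)) ^ a := fun a => by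
    rw [← mul_pow]; exact pow_le_pow_left₀ hP₁0 hP₁ a
  have hmpow : mr ^ n ≤ (2 : ℝ) ^ (n * n) := by
    rw [pow_mul]; exact pow_le_pow_left₀ hm0 hm n
  -- the exponent `e = n(n-1)/2`
  set e : ℕ := n * (n - 1) / 2 with he
  have he2 : e * 2 = n * (n - 1) := Nat.div_mul_cancel (Nat.even_mul_pred_self n).two_dvd
  have her : (e : ℝ) = (n : ℝ) * ((n : ℝ) - 1) / 2 := by
    have : ((e * 2 : ℕ) : ℝ) = ((n * (n - 1) : ℕ) : ℝ) := by rw [he2]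
    push_cast [Nat.cast_sub hn1] at this
    linarith
  have hxnat : ∀ a : ℕ, x ^ a = x ^ (a : ℝ) := fun a => (Real.rpow_natCast x a).symm
  set τ : ℝ := 2 * ((n + s : ℕ) : ℝ) + n * (3 * (n : ℝ) - 5) / 2 with hτ
  -- Term B
  have hB : ((n + s : ℕ) : ℝ) ^ (2 * n) * (pr ^ (2 * s) * (pr * P₁r) ^ n *
      ((Nat.factorial n : ℝ) * mr ^ n * pr ^ e)) ≤
      ((n + s : ℕ) : ℝ) ^ (2 * n) * (Nat.factorial n) * 2 ^ (n * n) * 3 ^ n * x ^ τ := by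
    have h1 : (pr * P₁r) ^ n ≤ x ^ n * ((3 : ℝ) ^ n * (x ^ (n - 1)) ^ n) := by
      rw [mul_pow]; exact mul_le_mul (hpow n) (hP₁pow n) (by positivity) (by positivity)
    have h2 : pr ^ (2 * s) * (pr * P₁r) ^ n * ((Nat.factorial n : ℝ) * mr ^ n * pr ^ e)
        ≤ x ^ (2 * s) * (x ^ n * ((3 : ℝ) ^ n * (x ^ (n - 1)) ^ n)) *
          ((Nat.factorial n : ℝ) * (2 : ℝ) ^ (n * n) * x ^ e) := by
      have hC : (Nat.factorial n : ℝ) * mr ^ n * pr ^ e ≤ (Nat.factorial n : ℝ) * (2 : ℝ) ^ (n * n) * x ^ e :=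
        mul_le_mul (mul_le_mul_of_nonneg_left hmpow (by positivity)) (hpow e) (by positivity)
          (by positivity)
      exact mul_le_mul (mul_le_mul (hpow _) h1 (by positivity) (by positivity)) hC (by positivity)
        (by positivity)
    have h3 : x ^ (2 * s) * (x ^ n * ((3 : ℝ) ^ n * (x ^ (n - 1)) ^ n)) *
          ((Nat.factorial n : ℝ) * (2 : ℝ) ^ (n * n) * x ^ e)
        = (Nat.factorial n) * 2 ^ (n * n) * 3 ^ n * x ^ (2 * s + n + (n - 1) * n + e) := by
      rw [← pow_mul]; ring
    have h4 : x ^ (2 * s + n + (n - 1) * n + e) = x ^ τ := by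
      rw [hxnat, hτ]
      congr 1
      push_cast [Nat.cast_sub hn1]
      rw [her]; ring
    calc _ ≤ ((n + s : ℕ) : ℝ) ^ (2 * n) * (x ^ (2 * s) * (x ^ n * ((3 : ℝ) ^ n * (x ^ (n - 1)) ^ n)) *
          ((Nat.factorial n : ℝ) * (2 : ℝ) ^ (n * n) * x ^ e)) :=
          mul_le_mul_of_nonneg_left h2 (by positivity)
      _ = _ := by rw [h3, h4]; ring
  -- Term A: `n^{n+s} ≤ x^{δ}`, `δ = (n+s) + 1 − n(n+3)/2`
  set δ : ℝ := ((n + s : ℕ) : ℝ) + 1 - (n : ℝ) * ((n : ℝ) + 3) / 2 with hδ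
  have hk' : ((n ^ 2 + n : ℕ) : ℝ) ≤ ((n + s : ℕ) : ℝ) := by exact_mod_cast hk
  push_cast at hk'
  have hδ0 : 0 ≤ δ := by rw [hδ]; push_cast; nlinarith
  have h4δ : ((n + s : ℕ) : ℝ) ≤ 4 * δ := by rw [hδ]; push_cast; nlinarith
  have hA0 : (n : ℝ) ^ (n + s) ≤ x ^ δ := by
    calc (n : ℝ) ^ (n + s) = (n : ℝ) ^ (((n + s : ℕ) : ℝ)) := (Real.rpow_natCast _ _).symm
      _ ≤ (n : ℝ) ^ (4 * δ) := Real.rpow_le_rpow_of_exponent_le hn1r h4δ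
      _ = ((n : ℝ) ^ 4) ^ δ := by
          rw [Real.rpow_mul (by positivity)]; norm_num
      _ ≤ x ^ δ := Real.rpow_le_rpow (by positivity) hxn4 hδ0
  have hA : 2 * ((pr ^ (n - 1) * (n : ℝ) ^ (n + s)) * pr ^ (n + s) * P₁r ^ (2 * n)) ≤
      2 * 9 ^ n * x ^ τ := by
    have h1 : (pr ^ (n - 1) * (n : ℝ) ^ (n + s)) * pr ^ (n + s) * P₁r ^ (2 * n) ≤
        (x ^ (n - 1) * x ^ δ) * x ^ (n + s) * ((3 : ℝ) ^ (2 * n) * (x ^ (n - 1)) ^ (2 * n)) := by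
      exact mul_le_mul (mul_le_mul (mul_le_mul (hpow _) hA0 (by positivity) (by positivity)) (hpow _)
        (by positivity) (by positivity)) (hP₁pow _) (by positivity) (by positivity)
    have h2 : (x ^ (n - 1) * x ^ δ) * x ^ (n + s) * ((3 : ℝ) ^ (2 * n) * (x ^ (n - 1)) ^ (2 * n))
        = 9 ^ n * x ^ τ := by
      have e1 : (x ^ (n - 1) * x ^ δ) * x ^ (n + s) * ((3 : ℝ) ^ (2 * n) * (x ^ (n - 1)) ^ (2 * n))
          = 9 ^ n * (x ^ ((n - 1 : ℕ) : ℝ) * x ^ δ * x ^ ((n + s : ℕ) : ℝ) *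
              x ^ ((((n - 1) * (2 * n) : ℕ) : ℝ))) := by
        rw [← pow_mul, pow_mul (3 : ℝ) 2 n, show (3 : ℝ) ^ 2 = 9 by norm_num, hxnat (n - 1),
          hxnat (n + s), hxnat ((n - 1) * (2 * n))]
        ring
      rw [e1, ← Real.rpow_add hx0, ← Real.rpow_add hx0, ← Real.rpow_add hx0]
      congr 2
      rw [hδ, hτ]
      push_cast [Nat.cast_sub hn1]
      ring
    linarith [h1, h2.le, h2.ge]
  calc _ ≤ 2 * 9 ^ n * x ^ τ + ((n + s : ℕ) : ℝ) ^ (2 * n) * (Nat.factorial n) * 2 ^ (n * n) * 3 ^ n *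
          x ^ τ := add_le_add hA hB
    _ = C62 n (n + s) * x ^ τ := by unfold C62; ring

/-- **Ivić, Lemma 6.2 (the recurrent inequality for Vinogradov's mean value).** Let `n ≥ 2`,
`k ≥ n² + n` and `P ≥ n^{4n}`. Then there is an integer `P₁` with `P^{1−1/n} < P₁ ≤ 3P^{1−1/n}`
such that

  `J_{k,n}([1,P]) ≤ C₆₂(n,k) · P^{2k/n + (3n−5)/2} · J_{k−n,n}([1,P₁])`,

`C₆₂(n,k) = 2·9ⁿ + k^{2n} n! 2^{n²} 3ⁿ`. (Printed: `P ≥ (2n)^{3n}`, constant `4^{2k}`,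
`P^{1−1/n} ≤ P₁ ≤ 4P^{1−1/n}`; see the module docstring.) [cite: Ivic1985, Lemma 6.2] -/
theorem lemma62 {n k P : ℕ} (hn : 2 ≤ n) (hk : n ^ 2 + n ≤ k) (hP : n ^ (4 * n) ≤ P) :
    ∃ P₁ : ℕ, 1 ≤ P₁ ∧ (P : ℝ) ^ (1 - 1 / (n : ℝ)) < P₁ ∧ (P₁ : ℝ) ≤ 3 * (P : ℝ) ^ (1 - 1 / (n : ℝ)) ∧
      (J n k (Finset.Icc 1 (P : ℤ)) : ℝ) ≤
        C62 n k * (P : ℝ) ^ (2 * (k : ℝ) / n + (3 * (n : ℝ) - 5) / 2) *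
          J n (k - n) (Finset.Icc 1 (P₁ : ℤ)) := by
  -- the variables `n`, `s = k - n`
  obtain ⟨s, rfl⟩ : ∃ s, k = n + s := ⟨k - n, by omega⟩
  rw [Nat.add_sub_cancel_left]
  have hn1 : 1 ≤ n := by omega
  have hn0 : (n : ℕ) ≠ 0 := by omega
  have hs1 : 1 ≤ s := by nlinarith
  have hP1 : 1 ≤ P := le_trans (Nat.one_le_pow _ _ (by omega)) hP
  have hPr : (0 : ℝ) < P := by exact_mod_cast (by omega : 0 < P)
  -- steps 1–3
  obtain ⟨p, hp, hnp, hpnP, hP2p, hxn4, hpx, hxp⟩ := lemma62_prime hn hP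
  have hp0 : 0 < p := hp.pos
  obtain ⟨hmP, hPpP₁, hm2⟩ := lemma62_params (n := n) (P := P) hn1 hp0 hP2p
  set x : ℝ := (P : ℝ) ^ ((n : ℝ)⁻¹) with hx
  have hxn : x ^ n = (P : ℝ) := by rw [hx]; exact Real.rpow_inv_natCast_pow hPr.le hn0
  have hn4 : (1 : ℝ) ≤ (n : ℝ) ^ 4 := one_le_pow₀ (by exact_mod_cast hn1)
  have hx1 : 1 ≤ x := hn4.trans hxn4
  obtain ⟨hP₁lo, hP₁hi⟩ := lemma62_P₁_bounds (P := P) hn1 hp0 hx1 hxn hpx hxp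
  set P₁ : ℕ := P / p + 1 with hP₁
  set m : ℕ := P / p ^ n + 1 with hm
  have hxn1 : x ^ (n - 1) = (P : ℝ) ^ (1 - 1 / (n : ℝ)) := by
    have h1 : (P : ℝ) ^ (1 - 1 / (n : ℝ)) = x ^ (((n - 1 : ℕ) : ℝ)) := by
      rw [hx, ← Real.rpow_mul hPr.le]
      congr 1
      rw [Nat.cast_sub hn1]; field_simp; ring
    rw [h1, Real.rpow_natCast]
  have hP₁1 : 1 ≤ P₁ := Nat.le_add_left 1 _
  refine ⟨P₁, hP₁1, hxn1 ▸ hP₁lo, hxn1 ▸ hP₁hi, ?_⟩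
  -- the structural recurrence on `[1, pP₁] ⊇ [1, P]`
  have hstruct := J_IQ_le_struct (s := s) (P₁ := P₁) (m := m) hp hnp hn1 hs1 hmP
  have hmono : J n (n + s) (Finset.Icc 1 (P : ℤ)) ≤ J n (n + s) (IQ p P₁) := by
    unfold J
    refine Jc_mono n (n + s) ?_ 0
    unfold IQ
    exact Finset.Icc_subset_Icc_right (by exact_mod_cast hPpP₁.le)
  rw [J_Icc_eq_J_Yset n s P₁]
  -- generalize the exponent `n(n-1)/2` (keeps `Nat.div` away from `ring`/`push_cast`)
  obtain ⟨e, he⟩ : ∃ e : ℕ, n * (n - 1) / 2 = e := ⟨_, rfl⟩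
  rw [he] at hstruct
  set B : ℕ := 2 * ((p ^ (n - 1) * n ^ (n + s)) * p ^ (n + s) * P₁ ^ (2 * n)) +
        (n + s) ^ (2 * n) * (p ^ (2 * s) * (p * P₁) ^ n *
          (Nat.factorial n * m ^ n * p ^ e)) with hB
  have hnat : J n (n + s) (Finset.Icc 1 (P : ℤ)) ≤ B * J n s (Yset P₁) := hmono.trans hstruct
  have hreal : (J n (n + s) (Finset.Icc 1 (P : ℤ)) : ℝ) ≤ (B : ℝ) * J n s (Yset P₁) := by
    exact_mod_cast hnat
  refine hreal.trans (mul_le_mul_of_nonneg_right ?_ (Nat.cast_nonneg _))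
  -- the real bound for `B`
  have hBr : (B : ℝ) = 2 * ((((p : ℝ)) ^ (n - 1) * (n : ℝ) ^ (n + s)) * (p : ℝ) ^ (n + s) * (P₁ : ℝ) ^ (2 * n)) +
      ((n + s : ℕ) : ℝ) ^ (2 * n) * ((p : ℝ) ^ (2 * s) * ((p : ℝ) * P₁) ^ n *
        ((Nat.factorial n : ℝ) * (m : ℝ) ^ n * (p : ℝ) ^ e)) := by
    rw [hB]; push_cast; ring
  have htarget : (P : ℝ) ^ (2 * ((n + s : ℕ) : ℝ) / n + (3 * (n : ℝ) - 5) / 2) =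
      x ^ (2 * ((n + s : ℕ) : ℝ) + n * (3 * (n : ℝ) - 5) / 2) := by
    rw [hx, ← Real.rpow_mul hPr.le]
    congr 1
    field_simp
  rw [hBr, htarget]
  have key := lemma62_terms_le (x := x) (pr := (p : ℝ)) (P₁r := (P₁ : ℝ)) (mr := (m : ℝ)) hn hk hxn4
    (Nat.cast_nonneg _) hpx (Nat.cast_nonneg _) hP₁hi (Nat.cast_nonneg _) (by exact_mod_cast hm2)
  rw [he] at key
  exact key


/-! ### The exponent `c_r` and the constant -/

/-- Ivić's `c_r = ½(n² + n)(1 − 1/n)^r`. [cite: Ivic1985, Lemma 6.3] -/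
def cr (n r : ℕ) : ℝ := ((n : ℝ) ^ 2 + n) / 2 * (1 - 1 / (n : ℝ)) ^ r

/-- `c_0 = ½(n² + n)`. [folklore] -/
theorem cr_zero (n : ℕ) : cr n 0 = ((n : ℝ) ^ 2 + n) / 2 := by simp [cr]

/-- `c_{r+1} = (1 − 1/n) c_r`. [folklore] -/
theorem cr_succ (n r : ℕ) : cr n (r + 1) = (1 - 1 / (n : ℝ)) * cr n r := by
  simp only [cr, pow_succ]; ring

/-- `0 ≤ 1 − 1/n` for `n ≥ 1`. [folklore] -/
theorem one_sub_inv_nonneg {n : ℕ} (hn : 1 ≤ n) : (0 : ℝ) ≤ 1 - 1 / (n : ℝ) := by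
  have : (1 : ℝ) ≤ n := by exact_mod_cast hn
  rw [sub_nonneg, div_le_one (by linarith)]; exact this

/-- `c_r ≥ 0`. [folklore] -/
theorem cr_nonneg {n : ℕ} (hn : 1 ≤ n) (r : ℕ) : 0 ≤ cr n r := by
  unfold cr; have := one_sub_inv_nonneg hn; positivity

/-- `c_r ≤ ½(n² + n)`. [folklore] -/
theorem cr_le {n : ℕ} (hn : 1 ≤ n) (r : ℕ) : cr n r ≤ ((n : ℝ) ^ 2 + n) / 2 := by
  unfold cr
  have h0 := one_sub_inv_nonneg hn
  have h1 : (1 - 1 / (n : ℝ)) ^ r ≤ 1 := pow_le_one₀ h0 (by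
    have : (0 : ℝ) ≤ 1 / (n : ℝ) := by positivity
    linarith)
  have h2 : (0 : ℝ) ≤ ((n : ℝ) ^ 2 + n) / 2 := by positivity
  calc ((n : ℝ) ^ 2 + n) / 2 * (1 - 1 / (n : ℝ)) ^ r ≤ ((n : ℝ) ^ 2 + n) / 2 * 1 :=
        mul_le_mul_of_nonneg_left h1 h2
    _ = _ := mul_one _

/-- The constant per step: `K(n,k) = 9^k C₆₂(n,k)`. [cite: Ivic1985, Lemma 6.3 (here in place of `(4n)^{4k}`)] -/
def K63 (n k : ℕ) : ℝ := 9 ^ k * C62 n k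

/-- `C₆₂ ≥ 2`. [folklore] -/
theorem two_le_C62 (n k : ℕ) : 2 ≤ C62 n k := by
  unfold C62
  have h1 : (1 : ℝ) ≤ 9 ^ n := one_le_pow₀ (by norm_num)
  have h2 : (0 : ℝ) ≤ (k : ℝ) ^ (2 * n) * (Nat.factorial n) * 2 ^ (n * n) * 3 ^ n := by positivity
  linarith

/-- `C₆₂(n, ·)` is monotone. [folklore] -/
theorem C62_mono (n : ℕ) {k k' : ℕ} (h : k ≤ k') : C62 n k ≤ C62 n k' := by
  unfold C62
  have : (k : ℝ) ^ (2 * n) ≤ (k' : ℝ) ^ (2 * n) :=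
    pow_le_pow_left₀ (Nat.cast_nonneg _) (by exact_mod_cast h) _
  gcongr

/-- `K ≥ 1`. [folklore] -/
theorem one_le_K63 (n k : ℕ) : 1 ≤ K63 n k := by
  unfold K63
  have h1 : (1 : ℝ) ≤ 9 ^ k := one_le_pow₀ (by norm_num)
  nlinarith [two_le_C62 n k]

/-- `K(n, ·)` is monotone. [folklore] -/
theorem K63_mono (n : ℕ) {k k' : ℕ} (h : k ≤ k') : K63 n k ≤ K63 n k' := by
  unfold K63
  have h1 : (9 : ℝ) ^ k ≤ 9 ^ k' := pow_le_pow_right₀ (by norm_num) h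
  have h2 := C62_mono n h
  have h3 : (0 : ℝ) ≤ C62 n k := by linarith [two_le_C62 n k]
  exact mul_le_mul h1 h2 h3 (by positivity)

/-! ### The trivial bound -/

/-- `#[1, P] = P`. [folklore] -/
theorem card_Icc_one (P : ℕ) : (Finset.Icc (1 : ℤ) P).card = P := by
  rw [Int.card_Icc]; simp

/-- The trivial bound `J_{k,n}([1,P]) ≤ P^{2k}`, real form. [cite: Ivic1985, §6.2 ("trivially `J_{k,n}(P) ≤ P^{2k}`")] -/
theorem J_Icc_le_rpow (n k P : ℕ) :
    (J n k (Finset.Icc (1 : ℤ) P) : ℝ) ≤ (P : ℝ) ^ (2 * (k : ℝ)) := by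
  have h := J_le_card_pow n k (Finset.Icc (1 : ℤ) P)
  rw [card_Icc_one] at h
  have h2 : (J n k (Finset.Icc (1 : ℤ) P) : ℝ) ≤ (P : ℝ) ^ (2 * k) := by exact_mod_cast h
  rwa [show (2 * (k : ℝ)) = ((2 * k : ℕ) : ℝ) by push_cast; ring, Real.rpow_natCast]

/-! ### Lemma 6.3 -/

/-- **Ivić, Lemma 6.3 (Vinogradov's mean value theorem), threshold-free form.** For `n ≥ 2`,
`r ≥ 0`, `k ≥ n² + nr` and every `P ≥ 1`,

  `J_{k,n}([1,P]) ≤ K(n,k)^r · n^{2n²(n+1)} · P^{2k − (n²+n)/2 + c_r}`,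

`c_r = ½(n²+n)(1 − 1/n)^r`, `K(n,k) = 9^k (2·9ⁿ + k^{2n} n! 2^{n²} 3ⁿ)`. (Printed: constant
`(4n)^{4kr}`, for `P ≥ P₀`.) Proof: induction on `r`; for `P ≥ n^{4n}` the recurrent inequality
(Lemma 6.2) and the induction hypothesis at `(k − n, P₁)`, using
`(1 − 1/n)(2(k−n) − (n²+n)/2 + c_r) + 2k/n + (3n−5)/2 = 2k − (n²+n)/2 + c_{r+1}`; for `P < n^{4n}`
the trivial bound. [cite: Ivic1985, Lemma 6.3] -/
theorem lemma63 {n : ℕ} (hn : 2 ≤ n) (r : ℕ) :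
    ∀ {k P : ℕ}, n ^ 2 + n * r ≤ k → 1 ≤ P →
      (J n k (Finset.Icc (1 : ℤ) P) : ℝ) ≤
        K63 n k ^ r * (n : ℝ) ^ (2 * n ^ 2 * (n + 1)) *
          (P : ℝ) ^ (2 * (k : ℝ) - ((n : ℝ) ^ 2 + n) / 2 + cr n r) := by
  have hn1 : 1 ≤ n := by omega
  have hn1r : (1 : ℝ) ≤ n := by exact_mod_cast hn1
  have hE1 : (1 : ℝ) ≤ (n : ℝ) ^ (2 * n ^ 2 * (n + 1)) := one_le_pow₀ hn1r
  induction r with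
  | zero =>
    intro k P _ hP
    have hP0 : (0 : ℝ) < P := by exact_mod_cast (by omega : 0 < P)
    rw [pow_zero, one_mul, cr_zero, show 2 * (k : ℝ) - ((n : ℝ) ^ 2 + n) / 2 + ((n : ℝ) ^ 2 + n) / 2
      = 2 * (k : ℝ) by ring]
    calc (J n k (Finset.Icc (1 : ℤ) P) : ℝ) ≤ (P : ℝ) ^ (2 * (k : ℝ)) := J_Icc_le_rpow n k P
      _ ≤ (n : ℝ) ^ (2 * n ^ 2 * (n + 1)) * (P : ℝ) ^ (2 * (k : ℝ)) :=
          le_mul_of_one_le_left (by positivity) hE1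
  | succ r ih =>
    intro k P hk hP
    have hP0 : (0 : ℝ) < P := by exact_mod_cast (by omega : 0 < P)
    have hP1 : (1 : ℝ) ≤ P := by exact_mod_cast hP
    have hkn : n ^ 2 + n ≤ k := le_trans (by nlinarith) hk
    have hK1 := one_le_K63 n k
    set τ : ℝ := 2 * (k : ℝ) - ((n : ℝ) ^ 2 + n) / 2 + cr n (r + 1) with hτ
    by_cases hPT : n ^ (4 * n) ≤ P
    · -- the recurrent inequality
      obtain ⟨P₁, hP₁1, hlo, hhi, hJ⟩ := lemma62 hn hkn hPT
      have hP₁0 : (0 : ℝ) < P₁ := by exact_mod_cast (by omega : 0 < P₁)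
      have hk' : n ^ 2 + n * r ≤ k - n := by
        have : n ^ 2 + n * (r + 1) = n ^ 2 + n * r + n := by ring
        omega
      have hIH := ih hk' hP₁1
      -- the exponent of `P₁` is nonnegative
      set ε : ℝ := 2 * ((k - n : ℕ) : ℝ) - ((n : ℝ) ^ 2 + n) / 2 + cr n r with hε
      have hkn' : ((n ^ 2 + n : ℕ) : ℝ) ≤ ((k - n : ℕ) : ℝ) + n := by
        have : n ^ 2 + n ≤ (k - n) + n := by omega
        exact_mod_cast this
      push_cast at hkn'
      have hε0 : 0 ≤ ε := by
        rw [hε]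
        have h1 := cr_nonneg hn1 r
        have h2 : (1 : ℝ) ≤ n := hn1r
        nlinarith
      have hε2k : ε ≤ 2 * (k : ℝ) := by
        rw [hε]
        have h1 := cr_le hn1 r
        have h3 : ((k - n : ℕ) : ℝ) ≤ k := by exact_mod_cast Nat.sub_le k n
        nlinarith
      -- `P₁^ε ≤ 9^k P^{(1-1/n) ε}`
      have hQ0 : (0 : ℝ) ≤ (P : ℝ) ^ (1 - 1 / (n : ℝ)) := Real.rpow_nonneg hP0.le _
      have hP₁ε : (P₁ : ℝ) ^ ε ≤ 9 ^ k * (P : ℝ) ^ ((1 - 1 / (n : ℝ)) * ε) := by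
        calc (P₁ : ℝ) ^ ε ≤ (3 * (P : ℝ) ^ (1 - 1 / (n : ℝ))) ^ ε :=
              Real.rpow_le_rpow hP₁0.le hhi hε0
          _ = 3 ^ ε * (P : ℝ) ^ ((1 - 1 / (n : ℝ)) * ε) := by
              rw [Real.mul_rpow (by norm_num) hQ0, ← Real.rpow_mul hP0.le]
          _ ≤ 9 ^ k * (P : ℝ) ^ ((1 - 1 / (n : ℝ)) * ε) := by
              refine mul_le_mul_of_nonneg_right ?_ (Real.rpow_nonneg hP0.le _)
              calc (3 : ℝ) ^ ε ≤ 3 ^ (2 * (k : ℝ)) :=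
                    Real.rpow_le_rpow_of_exponent_le (by norm_num) hε2k
                _ = 9 ^ k := by
                    rw [show (2 * (k : ℝ)) = ((2 * k : ℕ) : ℝ) by push_cast; ring,
                      Real.rpow_natCast, pow_mul]; norm_num
      -- combine the powers of `P`
      have hexp : (P : ℝ) ^ (2 * (k : ℝ) / n + (3 * (n : ℝ) - 5) / 2) *
          (P : ℝ) ^ ((1 - 1 / (n : ℝ)) * ε) = (P : ℝ) ^ τ := by
        rw [← Real.rpow_add hP0]
        congr 1
        rw [hτ, hε, cr_succ]
        have hnn : (n : ℝ) ≠ 0 := by positivity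
        have hkr : ((k - n : ℕ) : ℝ) = (k : ℝ) - n := by
          rw [Nat.cast_sub (by omega)]
        rw [hkr]
        field_simp
        ring
      -- constants
      have hKK : C62 n k * K63 n (k - n) ^ r * 9 ^ k ≤ K63 n k ^ (r + 1) := by
        have h1 : K63 n (k - n) ^ r ≤ K63 n k ^ r :=
          pow_le_pow_left₀ (by linarith [one_le_K63 n (k - n)]) (K63_mono n (Nat.sub_le k n)) r
        have h2 : (0 : ℝ) ≤ C62 n k := by linarith [two_le_C62 n k]
        calc C62 n k * K63 n (k - n) ^ r * 9 ^ k = K63 n k * K63 n (k - n) ^ r := by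
              unfold K63; ring
          _ ≤ K63 n k * K63 n k ^ r := mul_le_mul_of_nonneg_left h1 (by linarith)
          _ = K63 n k ^ (r + 1) := by ring
      -- assemble
      have hC0 : (0 : ℝ) ≤ C62 n k := by linarith [two_le_C62 n k]
      calc (J n k (Finset.Icc (1 : ℤ) P) : ℝ)
          ≤ C62 n k * (P : ℝ) ^ (2 * (k : ℝ) / n + (3 * (n : ℝ) - 5) / 2) *
              J n (k - n) (Finset.Icc 1 (P₁ : ℤ)) := hJ
        _ ≤ C62 n k * (P : ℝ) ^ (2 * (k : ℝ) / n + (3 * (n : ℝ) - 5) / 2) *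
              (K63 n (k - n) ^ r * (n : ℝ) ^ (2 * n ^ 2 * (n + 1)) * (P₁ : ℝ) ^ ε) :=
            mul_le_mul_of_nonneg_left hIH (by positivity)
        _ ≤ C62 n k * (P : ℝ) ^ (2 * (k : ℝ) / n + (3 * (n : ℝ) - 5) / 2) *
              (K63 n (k - n) ^ r * (n : ℝ) ^ (2 * n ^ 2 * (n + 1)) *
                (9 ^ k * (P : ℝ) ^ ((1 - 1 / (n : ℝ)) * ε))) := by
            have h0 : (0 : ℝ) ≤ K63 n (k - n) ^ r * (n : ℝ) ^ (2 * n ^ 2 * (n + 1)) := by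
              have := one_le_K63 n (k - n); positivity
            exact mul_le_mul_of_nonneg_left (mul_le_mul_of_nonneg_left hP₁ε h0) (by positivity)
        _ = (C62 n k * K63 n (k - n) ^ r * 9 ^ k) * (n : ℝ) ^ (2 * n ^ 2 * (n + 1)) *
              ((P : ℝ) ^ (2 * (k : ℝ) / n + (3 * (n : ℝ) - 5) / 2) *
                (P : ℝ) ^ ((1 - 1 / (n : ℝ)) * ε)) := by ring
        _ ≤ K63 n k ^ (r + 1) * (n : ℝ) ^ (2 * n ^ 2 * (n + 1)) *
              ((P : ℝ) ^ (2 * (k : ℝ) / n + (3 * (n : ℝ) - 5) / 2) *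
                (P : ℝ) ^ ((1 - 1 / (n : ℝ)) * ε)) := by
            refine mul_le_mul_of_nonneg_right (mul_le_mul_of_nonneg_right hKK (by positivity)) ?_
            positivity
        _ = _ := by rw [hexp]
    · -- small `P`: the trivial bound
      push Not at hPT
      have hPT' : (P : ℝ) ≤ (n : ℝ) ^ (4 * n) := by exact_mod_cast hPT.le
      have hβ0 : 0 ≤ ((n : ℝ) ^ 2 + n) / 2 - cr n (r + 1) := by linarith [cr_le hn1 (r + 1)]
      have hsplit : (P : ℝ) ^ (2 * (k : ℝ)) = (P : ℝ) ^ τ * (P : ℝ) ^ (((n : ℝ) ^ 2 + n) / 2 - cr n (r + 1)) := by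
        rw [← Real.rpow_add hP0]; congr 1; rw [hτ]; ring
      have hsmall : (P : ℝ) ^ (((n : ℝ) ^ 2 + n) / 2 - cr n (r + 1)) ≤ (n : ℝ) ^ (2 * n ^ 2 * (n + 1)) := by
        calc (P : ℝ) ^ (((n : ℝ) ^ 2 + n) / 2 - cr n (r + 1))
            ≤ (P : ℝ) ^ (((n : ℝ) ^ 2 + n) / 2) :=
              Real.rpow_le_rpow_of_exponent_le hP1 (by linarith [cr_nonneg hn1 (r + 1)])
          _ ≤ ((n : ℝ) ^ (4 * n)) ^ (((n : ℝ) ^ 2 + n) / 2) :=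
              Real.rpow_le_rpow hP0.le hPT' (by positivity)
          _ = (n : ℝ) ^ (2 * n ^ 2 * (n + 1)) := by
              rw [← Real.rpow_natCast (n : ℝ) (4 * n), ← Real.rpow_mul (by positivity),
                ← Real.rpow_natCast (n : ℝ) (2 * n ^ 2 * (n + 1))]
              congr 1; push_cast; ring
      calc (J n k (Finset.Icc (1 : ℤ) P) : ℝ) ≤ (P : ℝ) ^ (2 * (k : ℝ)) := J_Icc_le_rpow n k P
        _ = (P : ℝ) ^ τ * (P : ℝ) ^ (((n : ℝ) ^ 2 + n) / 2 - cr n (r + 1)) := hsplit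
        _ ≤ (P : ℝ) ^ τ * (n : ℝ) ^ (2 * n ^ 2 * (n + 1)) :=
            mul_le_mul_of_nonneg_left hsmall (Real.rpow_nonneg hP0.le _)
        _ ≤ K63 n k ^ (r + 1) * ((P : ℝ) ^ τ * (n : ℝ) ^ (2 * n ^ 2 * (n + 1))) :=
            le_mul_of_one_le_left (by positivity) (one_le_pow₀ hK1)
        _ = _ := by ring

/-- **Corollary in the shape used for zeta sums** (Ivić, proof of Theorem 6.2: Lemma 6.3 with
`k = r² + (Rr)r` for the degree `r`): for `n ≥ 2`, `R ≥ 0` and `P ≥ 1`,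
`J_{n²+Rn·n, n}([1,P]) ≤ K(n, n²+Rn²)^{Rn} n^{2n²(n+1)} P^{2k − (n²+n)/2 + c_{Rn}}`, `k = n² + Rn²`.
[cite: Ivic1985, Lemma 6.3 and (6.44)] -/
theorem lemma63_sq {n : ℕ} (hn : 2 ≤ n) (R : ℕ) {P : ℕ} (hP : 1 ≤ P) :
    (J n (n ^ 2 + R * n * n) (Finset.Icc (1 : ℤ) P) : ℝ) ≤
      K63 n (n ^ 2 + R * n * n) ^ (R * n) * (n : ℝ) ^ (2 * n ^ 2 * (n + 1)) *
        (P : ℝ) ^ (2 * ((n ^ 2 + R * n * n : ℕ) : ℝ) - ((n : ℝ) ^ 2 + n) / 2 + cr n (R * n)) :=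
  lemma63 hn (R * n) (by nlinarith) hP


/-- **The case `k = 5n²`, `r = 4n`** (Ivić's final choice `R = 4` in the proof of Theorem 6.2, (6.45)–(6.46)):
for `n ≥ 2` and `P ≥ 1`,
`J_{5n²,n}([1,P]) ≤ K(n,5n²)^{4n} n^{2n²(n+1)} P^{10n² − (n²+n)/2 + c_{4n}}`, `c_{4n} = ½(n²+n)(1−1/n)^{4n}`.
[cite: Ivic1985, Lemma 6.3 and (6.46)] -/
theorem lemma63_five_sq {n : ℕ} (hn : 2 ≤ n) {P : ℕ} (hP : 1 ≤ P) :
    (J n (5 * n ^ 2) (Finset.Icc (1 : ℤ) P) : ℝ) ≤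
      K63 n (5 * n ^ 2) ^ (4 * n) * (n : ℝ) ^ (2 * n ^ 2 * (n + 1)) *
        (P : ℝ) ^ (2 * ((5 * n ^ 2 : ℕ) : ℝ) - ((n : ℝ) ^ 2 + n) / 2 + cr n (4 * n)) :=
  lemma63 hn (4 * n) (by nlinarith) hP

end VMV
end Literature.NumberTheory.LFunctions
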